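import Summits.ResolutionOfSingularities.KangarooAtlas.MizutaniRationalPointDual
import Summits.ResolutionOfSingularities.KangarooAtlas.MizutaniInvFormsLevel
import HarnessLib

/-!
# Every `k^{1/q}`-rational point `[c^{1/q}]` is a closed point of `ℙ^n_k`

Cell `pub-rosobs`, Mizutani enclosure (seat mizutani-encloser-2, gen 8). AI-written; AI review is weaker than expert review;
NOT a resolution-of-singularities theorem (summit relevance C).

Mizutani (Nagoya Math. J. 52 (1973)) repeatedly uses that the schemes of Example 2.1 / Remark 2.10 are «associated with a closed point in
`ℙ^{2p−1}`» and, in the proof of Thm. 2.8, Step (I) (p. 91), that «the most generic point associated with `H` is a closed point».  The points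
in question are the `k^{1/q}`-RATIONAL POINTS `ratPoint k p e c = [c_0^{1/q} : ⋯ : c_n^{1/q}]` of the tree (`MizutaniRationalPoint.lean`; the
extremal points of Thm. 2.8 by `exists_eq_ratPoint_of_extremal`).  This file proves that they are CLOSED points of `Proj S`: no homogeneous prime
other than the irrelevant one lies strictly above them.

* **`irrelevant_le_of_ratPoint_lt`** — if `𝔮` is a homogeneous prime with `[c^{1/q}] ⊊ 𝔮` then `(X_0, …, X_n) ⊆ 𝔮`: a homogeneous `g ∈ 𝔮 ∖ [c^{1/q}]`
  of degree `d ≥ 1` satisfies `g^q − (χ(g)/c_{i₀}^d)·X_{i₀}^{dq} ∈ [c^{1/q}]` (`χ(g) = g^{(F^e)}(c) ≠ 0`), so `X_{i₀} ∈ 𝔮`, and then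
  `c_{i₀} X_i^q − c_i X_{i₀}^q ∈ [c^{1/q}]` gives `X_i ∈ 𝔮` for all `i`;
* **`eq_ratPoint_of_le`** — a point `𝔮` of `ℙ^n_k` containing `[c^{1/q}]` IS `[c^{1/q}]`.

## References

* H. Mizutani, *Hironaka's additive group schemes*, Nagoya Math. J. 52 (1973) 85–95, Example 2.1, Thm. 2.8 (proof, Step (I)), Remark 2.10.
  [Mizutani1973HironakaGroupSchemes]
* T. Oda, *Hironaka's additive group scheme, II*, Publ. RIMS 19 (1983), Thm. 3.1 (p. 1173: the point attached to `φ`). [Oda1983HironakaGroupSchemeII]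
-/

noncomputable section

open MvPolynomial Literature.AlgebraicGeometry.Resolution Literature.AlgebraicGeometry.Resolution.HironakaScheme

namespace Summit.ResolutionOfSingularities.KangarooAtlas.Mizutani

universe u

section Closed

variable {k : Type u} [Field k] {p e : ℕ} [hp : Fact p.Prime] [CharP k p] {n : ℕ} {c : Fin (n + 1) → k}

/-- **`[c^{1/q}]` IS A CLOSED POINT**: a homogeneous prime strictly above `ratPoint k p e c` (`c ≠ 0`) contains every variable, i.e. the
irrelevant ideal. [cite: Mizutani1973HironakaGroupSchemes, Example 2.1 («associated with a closed point») and Thm. 2.8, proof, Step (I)] -/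
theorem irrelevant_le_of_ratPoint_lt (hc : c ≠ 0) {𝔮 : Ideal (MvPolynomial (Fin (n + 1)) k)} [h𝔮 : 𝔮.IsPrime]
    (hhom : ∀ f ∈ 𝔮, ∀ d : ℕ, homogeneousComponent d f ∈ 𝔮) (hlt : ratPoint k p e c < 𝔮) :
    irrelevant k n ≤ 𝔮 := by
  classical
  obtain ⟨i₀, hi₀⟩ : ∃ i, c i ≠ 0 := by
    by_contra hn
    push Not at hn
    exact hc (funext hn)
  -- a homogeneous `g ∈ 𝔮 ∖ [c^{1/q}]`
  obtain ⟨hle, f, hf𝔮, hf𝔭⟩ := SetLike.lt_iff_le_and_exists.mp hlt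
  obtain ⟨d, hg𝔭⟩ : ∃ d, homogeneousComponent d f ∉ ratPoint k p e c := by
    by_contra hall
    push Not at hall
    apply hf𝔭
    rw [← sum_homogeneousComponent f]
    exact Ideal.sum_mem _ fun d _ => hall d
  set g := homogeneousComponent d f with hg
  have hg𝔮 : g ∈ 𝔮 := hhom f hf𝔮 d
  have hghom : g.IsHomogeneous d := homogeneousComponent_isHomogeneous d f
  have hχ : ratChi k p e c g ≠ 0 := fun h0 => hg𝔭 ((mem_ratPoint_iff_of_isHomogeneous hghom).mpr h0)
  -- `d ≥ 1` (a nonzero constant in `𝔮` is impossible)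
  have hd : 1 ≤ d := by
    rcases Nat.eq_zero_or_pos d with hd0 | hd0
    · exfalso
      have hgC : g = C (coeff 0 f) := by rw [hg, hd0, homogeneousComponent_zero]
      have hg0 : coeff 0 f ≠ 0 := by
        intro h0
        apply hg𝔭
        rw [hgC, h0, C_0]
        exact Ideal.zero_mem _
      exact h𝔮.ne_top (Ideal.eq_top_of_isUnit_mem _ hg𝔮 (by rw [hgC]; exact IsUnit.map C (Ne.isUnit hg0)))
    · exact hd0
  -- `g^q − b • X_{i₀}^{dq} ∈ [c^{1/q}]` with `b = χ(g)/c_{i₀}^d`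
  set b : k := ratChi k p e c g / c i₀ ^ d with hb
  have hbq : b ^ p ^ e * c i₀ ^ (d * p ^ e) = ratChi k p e c g ^ p ^ e := by
    rw [pow_mul, ← mul_pow, hb, div_mul_cancel₀ _ (pow_ne_zero d hi₀)]
  have hC : ratPsi k p e c (C b) = Polynomial.C (b ^ p ^ e) := by
    unfold ratPsi
    rw [eval₂Hom_C, RingHom.comp_apply, iterateFrobenius_def]
  have hmem : g ^ p ^ e - C b * X i₀ ^ (d * p ^ e) ∈ ratPoint k p e c := by
    unfold ratPoint
    rw [RingHom.mem_ker, map_sub, map_pow (ratPsi k p e c), ratPsi_of_isHomogeneous hghom, Polynomial.monomial_pow,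
      map_mul, map_pow (ratPsi k p e c), ratPsi_X, mul_pow, ← map_pow Polynomial.C, ← mul_assoc, hC, ← map_mul,
      hbq, Polynomial.C_mul_X_pow_eq_monomial, sub_self]
  -- hence `X_{i₀} ∈ 𝔮`
  have hX₀ : (X i₀ : MvPolynomial (Fin (n + 1)) k) ∈ 𝔮 := by
    have h1 : C b * X i₀ ^ (d * p ^ e) ∈ 𝔮 := by
      have h2 := hle hmem
      have h3 : g ^ p ^ e ∈ 𝔮 := Ideal.pow_mem_of_mem 𝔮 hg𝔮 _ (pow_pos hp.out.pos e)
      have := Ideal.sub_mem 𝔮 h3 h2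
      rwa [sub_sub_cancel] at this
    have hb0 : b ≠ 0 := div_ne_zero hχ (pow_ne_zero d hi₀)
    have h4 : (X i₀ : MvPolynomial (Fin (n + 1)) k) ^ (d * p ^ e) ∈ 𝔮 :=
      (Ideal.unit_mul_mem_iff_mem 𝔮 (IsUnit.map C (Ne.isUnit hb0))).mp h1
    exact h𝔮.mem_of_pow_mem _ h4
  -- and every `X_i ∈ 𝔮`
  refine irrelevant_le_of_X_mem k fun i => ?_
  have h5 : C (c i₀) * X i ^ p ^ e - C (c i) * X i₀ ^ p ^ e ∈ 𝔮 := hle (C_mul_X_pow_sub_mem_ratPoint i i₀)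
  have h6 : C (c i) * (X i₀ : MvPolynomial (Fin (n + 1)) k) ^ p ^ e ∈ 𝔮 :=
    Ideal.mul_mem_left 𝔮 _ (Ideal.pow_mem_of_mem 𝔮 hX₀ _ (pow_pos hp.out.pos e))
  have h7 : C (c i₀) * (X i : MvPolynomial (Fin (n + 1)) k) ^ p ^ e ∈ 𝔮 := by
    have := Ideal.add_mem 𝔮 h5 h6
    rwa [sub_add_cancel] at this
  have h8 : (X i : MvPolynomial (Fin (n + 1)) k) ^ p ^ e ∈ 𝔮 :=
    (Ideal.unit_mul_mem_iff_mem 𝔮 (IsUnit.map C (Ne.isUnit hi₀))).mp h7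
  exact h𝔮.mem_of_pow_mem _ h8

/-- **A point of `ℙ^n_k` containing `[c^{1/q}]` is `[c^{1/q}]`** (the `k^{1/q}`-rational points are closed points).
[cite: Mizutani1973HironakaGroupSchemes, Example 2.1 and Remark 2.10 («associated with a closed point»)] -/
theorem eq_ratPoint_of_le (hc : c ≠ 0) {𝔮 : Ideal (MvPolynomial (Fin (n + 1)) k)} (hQ : IsPoint k 𝔮)
    (hle : ratPoint k p e c ≤ 𝔮) : 𝔮 = ratPoint k p e c := by
  haveI := hQ.1
  rcases eq_or_lt_of_le hle with h | h
  · exact h.symm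
  · exact absurd (irrelevant_le_of_ratPoint_lt hc hQ.2.1 h) hQ.2.2

end Closed

end Summit.ResolutionOfSingularities.KangarooAtlas.Mizutani

end
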